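import Literature.MathematicalPhysics.QuantumFieldTheory.OSTimeSpaceTensor
import Literature.MathematicalPhysics.QuantumFieldTheory.OSSkeletonClusters
import Literature.Analysis.FunctionSpaces.TranslationAverageBounds
import Mathlib.MeasureTheory.Group.Integral
import HarnessLib

/-!
# Time-averaged skeleton clusters as time–space tensors (OS II, Ch. VI.1 regularisation)

Osterwalder–Schrader II (Comm. Math. Phys. 42 (1975)), Ch. VI.1: the vectors entering the bounds are
OS vectors of test functions *averaged over the times* of their points. For one-point functions of
product form `ψⱼ(y) = κⱼ(y⁰) hⱼ(y⃗)` (`onePtTensor`, time profile `κⱼ ∈ 𝓢(ℝ)`, spatial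
`hⱼ ∈ 𝓢(ℝ^{d'})`), the skeleton cluster at times `a` is
`⊗ⱼ ψⱼ(· - aⱼe₀) : x ↦ ∏ⱼ κⱼ(xⱼ⁰ - aⱼ) hⱼ(x⃗ⱼ)` (`skeletonFn_tensorFin_onePtTensor_apply`), and its
average against a joint weight `W ∈ 𝓢(ℝᵐ)` of the times is the **time–space tensor**

  `∫ W(a) ⊗ⱼ ψⱼ(· - aⱼe₀) da = (K ⋆ W) ⊗ (⊗ⱼ hⱼ)`,  `(K ⋆ W)(t) = ∫ K(b) W(t - b) db`,
  `K(b) = ∏ⱼ κⱼ(bⱼ)`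

(`avgCluster`, `avgCluster_apply_eq_integral`): the time factor is the tree's averaging operator
`translationAverage id K W` (derivatives fall on `W`, `TranslationAverageBounds`), so that its
Schwartz seminorms — and by `seminorm_timeSpaceTensor_le` those of the averaged cluster — are
bounded **uniformly in the width of the profiles `κⱼ`** (`seminorm_avgTime_le`). Combined with
`OSSuperposedVectors` (the OS vector of the averaged cluster is the average of the OS vectors) and
`OSVectorNormGrowth` (E0'), this gives the `w`-uniform bounds of Ch. VI.1.

## References

* K. Osterwalder, R. Schrader, *Axioms for Euclidean Green's functions II*, Comm. Math. Phys.
  42 (1975) 281–305, Ch. VI.1 pp. 297–298. [OsterwalderSchraderCMP1975]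
-/

noncomputable section

open MeasureTheory Set Filter
open _root_.Topology
open scoped InnerProductSpace NNReal SchwartzMap

namespace Literature.MathematicalPhysics.QuantumFieldTheory

variable {d' m : ℕ}

open Literature.MathematicalPhysics.QuantumLattice.SchwingerFamily (timeVec)
open Literature.Analysis.FunctionSpaces.SchwartzAverage

/-! ### One-point tensors `κ(y⁰) h(y⃗)` and their skeleton clusters -/

/-- Norm control of a point by its time and spatial parts, for `mulComp`. [folklore] -/
theorem norm_le_two_mul_max_coord (y : EuclideanSpace ℝ (Fin (d' + 1))) :
    ‖y‖ ≤ 2 * max ‖timeCoord y‖ ‖spacePart y‖ := by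
  rw [timeCoord_apply, Real.norm_eq_abs]; exact norm_le_two_mul_max y

/-- The **one-point tensor** `ψ(y) = κ(y⁰) h(y⃗)` of a time profile and a spatial test function. [cite: OsterwalderSchraderCMP1975, Ch. V (5.3)] -/
def onePtTensor (κ : 𝓢(ℝ, ℂ)) (h : 𝓢(EuclideanSpace ℝ (Fin d'), ℂ)) : 𝓢(EuclideanSpace ℝ (Fin (d' + 1)), ℂ) :=
  SchwartzMap.mulComp κ h timeCoord spacePart ⟨2, norm_le_two_mul_max_coord⟩

/-- Values of the one-point tensor. [folklore] -/
@[simp] theorem onePtTensor_apply (κ : 𝓢(ℝ, ℂ)) (h : 𝓢(EuclideanSpace ℝ (Fin d'), ℂ)) (y : EuclideanSpace ℝ (Fin (d' + 1))) :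
    onePtTensor κ h y = κ (y 0) * h (spacePart y) := rfl

/-- The spatial part does not see time shifts. [folklore] -/
@[simp] theorem spacePart_sub_timeVec (y : EuclideanSpace ℝ (Fin (d' + 1))) (t : ℝ) :
    spacePart (y - timeVec t) = spacePart y := by
  ext i
  simp [spacePart_apply, timeVec, Fin.succ_ne_zero]

/-- The time coordinate of a time shift. [folklore] -/
@[simp] theorem sub_timeVec_apply_zero (y : EuclideanSpace ℝ (Fin (d' + 1))) (t : ℝ) :
    (y - timeVec t : EuclideanSpace ℝ (Fin (d' + 1))) 0 = y 0 - t := by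
  simp [timeVec]

/-- **Skeleton clusters of one-point tensors**:
`(⊗ⱼ ψⱼ(· - aⱼe₀))(x) = (∏ⱼ κⱼ(xⱼ⁰ - aⱼ)) ∏ⱼ hⱼ(x⃗ⱼ)`. [folklore] -/
theorem skeletonFn_tensorFin_onePtTensor_apply (κ : Fin m → 𝓢(ℝ, ℂ)) (h : Fin m → 𝓢(EuclideanSpace ℝ (Fin d'), ℂ))
    (a : Fin m → ℝ) (x : Fin m → EuclideanSpace ℝ (Fin (d' + 1))) :
    skeletonFn (SchwartzMap.tensorFin m fun j => onePtTensor (κ j) (h j)) a x =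
      (∏ j, κ j (x j 0 - a j)) * ∏ j, h j (spacePart (x j)) := by
  simp only [skeletonFn_apply, SchwartzMap.tensorFin_apply, onePtTensor_apply, sub_timeVec_apply_zero,
    spacePart_sub_timeVec]
  exact Finset.prod_mul_distrib

/-! ### The product kernel and the averaged time factor -/

variable (m) in
/-- The identification `ℝᵐ (Euclidean) ≃L (Fin m → ℝ)`. [folklore] -/
abbrev eTime : EuclideanSpace ℝ (Fin m) ≃L[ℝ] (Fin m → ℝ) := EuclideanSpace.equiv (Fin m) ℝ

/-- A Schwartz function of the times on the Euclidean model `ℝᵐ`. [folklore] -/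
def toEucl (F : 𝓢((Fin m → ℝ), ℂ)) : 𝓢(EuclideanSpace ℝ (Fin m), ℂ) :=
  SchwartzMap.compCLMOfContinuousLinearEquiv ℂ (eTime m) F

/-- Back to the sup-norm model. [folklore] -/
def ofEucl (F : 𝓢(EuclideanSpace ℝ (Fin m), ℂ)) : 𝓢((Fin m → ℝ), ℂ) :=
  SchwartzMap.compCLMOfContinuousLinearEquiv ℂ (eTime m).symm F

/-- Values of `toEucl`. [folklore] -/
@[simp] theorem toEucl_apply (F : 𝓢((Fin m → ℝ), ℂ)) (t : EuclideanSpace ℝ (Fin m)) : toEucl F t = F (eTime m t) := by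
  simp [toEucl]

/-- Values of `ofEucl`. [folklore] -/
@[simp] theorem ofEucl_apply (F : 𝓢(EuclideanSpace ℝ (Fin m), ℂ)) (t : Fin m → ℝ) : ofEucl F t = F ((eTime m).symm t) := by
  simp [ofEucl]

variable (m) in
/-- The **product kernel** `K(b) = ∏ⱼ κⱼ(bⱼ)` of the time profiles, on `ℝᵐ`. [folklore] -/
def prodKernel (κ : Fin m → 𝓢(ℝ, ℂ)) : 𝓢(EuclideanSpace ℝ (Fin m), ℂ) := toEucl (SchwartzMap.tensorFin m κ)

/-- Values of the product kernel. [folklore] -/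
@[simp] theorem prodKernel_apply (κ : Fin m → 𝓢(ℝ, ℂ)) (b : EuclideanSpace ℝ (Fin m)) :
    prodKernel m κ b = ∏ j, κ j (b j) := by
  simp [prodKernel, SchwartzMap.tensorFin_apply]

variable (m) in
/-- The **averaged time factor** `(K ⋆ W)(t) = ∫ K(b) W(t - b) db` as a Schwartz function of the
times (the tree's averaging operator `translationAverage id K W`: the derivatives fall on `W`). [cite: OsterwalderSchraderCMP1975, Ch. VI.1] -/
def avgTime (κ : Fin m → 𝓢(ℝ, ℂ)) (W : 𝓢(EuclideanSpace ℝ (Fin m), ℂ)) : 𝓢((Fin m → ℝ), ℂ) :=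
  ofEucl (translationAverage (ContinuousLinearMap.id ℝ (EuclideanSpace ℝ (Fin m))) (prodKernel m κ) W)

/-- **Values of the averaged time factor**: `(K ⋆ W)(t) = ∫ (∏ⱼ κⱼ(bⱼ)) W(t - b) db`. [folklore] -/
theorem avgTime_apply (κ : Fin m → 𝓢(ℝ, ℂ)) (W : 𝓢(EuclideanSpace ℝ (Fin m), ℂ)) (t : Fin m → ℝ) :
    avgTime m κ W t = ∫ b : EuclideanSpace ℝ (Fin m), (∏ j, κ j (b j)) * W ((eTime m).symm t - b) := by
  rw [avgTime, ofEucl_apply, translationAverage_apply]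
  simp

/-- **Seminorm bound for the averaged time factor, uniform in the profile width**: if the kernel
vanishes outside the ball of radius `R`, then
`p_{k,l}(K ⋆ W) ≤ … 2ᵏ (1 + R)ᵏ ‖K‖₁ (p_{k,l}(W) + p_{0,l}(W))` up to the fixed constants of the
model identifications. [cite: OsterwalderSchraderCMP1975, Ch. VI.1] -/
theorem seminorm_translationAverage_prodKernel_le (κ : Fin m → 𝓢(ℝ, ℂ)) (W : 𝓢(EuclideanSpace ℝ (Fin m), ℂ))
    {R : ℝ} (hsupp : ∀ b : EuclideanSpace ℝ (Fin m), R < ‖b‖ → prodKernel m κ b = 0) (k l : ℕ) :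
    SchwartzMap.seminorm ℂ k l (translationAverage (ContinuousLinearMap.id ℝ (EuclideanSpace ℝ (Fin m))) (prodKernel m κ) W) ≤
      2 ^ k * (1 + ‖ContinuousLinearMap.id ℝ (EuclideanSpace ℝ (Fin m))‖ * R) ^ k *
        (∫ b, ‖prodKernel m κ b‖) * (SchwartzMap.seminorm ℂ k l W + SchwartzMap.seminorm ℂ 0 l W) :=
  seminorm_translationAverage_le_of_support _ _ W hsupp k l

/-! ### The averaged cluster -/

variable (d' m) in
/-- The **averaged cluster** `(K ⋆ W) ⊗ (⊗ⱼ hⱼ)`: the time–space tensor of the averaged time factor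
with the spatial test functions. [cite: OsterwalderSchraderCMP1975, Ch. VI.1] -/
def avgCluster (κ : Fin m → 𝓢(ℝ, ℂ)) (h : Fin m → 𝓢(EuclideanSpace ℝ (Fin d'), ℂ))
    (W : 𝓢(EuclideanSpace ℝ (Fin m), ℂ)) : 𝓢((Fin m → EuclideanSpace ℝ (Fin (d' + 1))), ℂ) :=
  timeSpaceTensor d' m (avgTime m κ W) (SchwartzMap.tensorFin m h)

/-- Values of the averaged cluster. [folklore] -/
theorem avgCluster_apply (κ : Fin m → 𝓢(ℝ, ℂ)) (h : Fin m → 𝓢(EuclideanSpace ℝ (Fin d'), ℂ))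
    (W : 𝓢(EuclideanSpace ℝ (Fin m), ℂ)) (x : Fin m → EuclideanSpace ℝ (Fin (d' + 1))) :
    avgCluster d' m κ h W x =
      (∫ b : EuclideanSpace ℝ (Fin m), (∏ j, κ j (b j)) * W ((eTime m).symm (fun j => x j 0) - b)) *
        ∏ j, h j (spacePart (x j)) := by
  rw [avgCluster, timeSpaceTensor_apply, avgTime_apply, SchwartzMap.tensorFin_apply]

/-- **The averaged cluster is the average of the skeleton clusters**:
`avgCluster x = ∫ W(a) (⊗ⱼ ψⱼ(· - aⱼe₀))(x) da` with `ψⱼ = onePtTensor κⱼ hⱼ`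
(substitution `b = x⁰ - a`). [cite: OsterwalderSchraderCMP1975, Ch. VI.1] -/
theorem avgCluster_apply_eq_integral (κ : Fin m → 𝓢(ℝ, ℂ)) (h : Fin m → 𝓢(EuclideanSpace ℝ (Fin d'), ℂ))
    (W : 𝓢(EuclideanSpace ℝ (Fin m), ℂ)) (x : Fin m → EuclideanSpace ℝ (Fin (d' + 1))) :
    avgCluster d' m κ h W x =
      ∫ a : EuclideanSpace ℝ (Fin m), W a *
        skeletonFn (SchwartzMap.tensorFin m fun j => onePtTensor (κ j) (h j)) (eTime m a) x := by
  rw [avgCluster_apply]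
  simp_rw [skeletonFn_tensorFin_onePtTensor_apply]
  rw [← integral_mul_const]
  -- substitute `b = x⁰ - a`
  set t : EuclideanSpace ℝ (Fin m) := (eTime m).symm fun j => x j 0 with ht
  have hsub := integral_sub_left_eq_self
    (fun a : EuclideanSpace ℝ (Fin m) => W a * ((∏ j, κ j (x j 0 - (eTime m a) j)) * ∏ j, h j (spacePart (x j))))
    volume t
  rw [← hsub]
  refine integral_congr_ae (Eventually.of_forall fun b => ?_)
  have hcoord : ∀ j, x j 0 - (eTime m (t - b)) j = b j := by
    intro j
    simp [ht]
  simp_rw [hcoord]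
  ring

end Literature.MathematicalPhysics.QuantumFieldTheory
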